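import Summits.PneNP.PneNP.Theorems.SzkEntropyPeaThreeNotInPLatticeStubSemantics
import Summits.PneNP.PneNP.Theorems.SzkEntropyPeaThreeNotInPLatticeStubReindex
import Summits.PneNP.PneNP.Theorems.SzkEntropyPeaThreeNotInPLatticeStubGeometry
import Summits.PneNP.PneNP.Theorems.SzkEntropyPeaThreeNotInPLatticeStubOverlap
import Summits.PneNP.PneNP.Theorems.SzkEntropyPeaThreeNotInPLatticeStubParams
import Summits.PneNP.PneNP.Theorems.SzkEntropyPeaThreeNotInPSocketPEDGap
import Summits.PneNP.PneNP.Theorems.SzkEntropyPeaThreeNotInPSocketMixtureLe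
import Summits.PneNP.PneNP.Theorems.SzkEntropyPeaThreeNotInPStubJSD
import HarnessLib

/-!
# Crux `PeaThreeNotInP` (stmt-PneNP-10776), line `SketchIdeator3`, socket client `lattice-cube-smoothing`:
# the entropy gap — preparations (`gap_entropies`, fixed instances, arithmetic)

The lead's stub of skeleton v6: the instance map `latRed : GapCVPInstance → PEDBPInst` sends
YES-instances of `GapCVP_n` (close: `dist(t, L(B)) ≤ d`) to NO-instances of `PEDBPGap 1 10`
(`H(p) + 1/10 ≤ H(q)`) and NO-instances (far: `dist > n d`) to YES-instances (`H(q) ≤ H(p)`).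

* dimension `0`: every promise instance is a YES-instance; the image `noI` (`H(p) = 0`,
  `H(q) = 1`, `bpEntropy_noI`);
* dimension `1`: `dist(t, g ℤ) = min (t mod |g|, |g| − t mod |g|)` (`geom_oneDim`) is compared
  with `d` exactly (`oneDimFar`), images `yesI` / `noI`;
* dimension `≥ 2`: by `stub_bpSemantics` + `stub_reindex` the two samplers have entropies
  `H(p) = H(b ? f : g)` and `H(q) = H(g) + 1` for the translates `f = g + K t`, `g(z, e) = K (z B) + e`
  on the box; far ⇒ disjoint images (`geom_far`, parameters from `stub_params`) ⇒
  `H(b ? f : g) ≥ H(g) + 1` (`mixture_entropy_ge`); close ⇒ overlap `≥ |Box|/10` (`geom_close`,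
  `stub_overlap`) ⇒ `H(b ? f : g) ≤ H(g) + 1 − 1/10` (`mixture_entropy_le`).

References: O. Goldreich, S. Goldwasser, JCSS 60 (2000) §3; Z. Dvir, D. Gutfreund, G. N. Rothblum,
S. Vadhan, ECCC TR10-160 (2010) §4.4.
-/

namespace Summit.PneNP.PneNP.Cruxes.PeaThreeNotInP.LatticeLine

set_option linter.dupNamespace false -- `Summit.PneNP.PneNP.…`: summit = sub-problem name (D-0017)

open Finset Metric
open Literature.InformationTheory.Entropy
open Literature.Computability.Complexity Literature.Algebra.EuclideanLattices
open Literature.Computability.Cryptography (toInput fnList)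
open Summit.PneNP.PneNP.Cruxes.PeaThreeNotInP.SocketBP (PEDBPGap encode_mem_PEDBPGap_yes_iff
  encode_mem_PEDBPGap_no_iff mixture_entropy_le)
open Summit.PneNP.PneNP.Cruxes.PeaThreeNotInP.TensorIsoLine (mixture_entropy_ge)

/-! ### The fixed instances -/

/-- The empty sampler has entropy `0`. [folklore] -/
theorem bpEntropy_nil (n : ℕ) : bpEntropy n [] = 0 := by
  unfold bpEntropy
  have h : bpMap n [] = fun _ => [] := by
    funext x
    simp [bpMap, fnList, compileAll]
  rw [h]
  exact Literature.InformationTheory.Entropy.mapEntropy_const _ _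

/-- `bitRaw` is a valid program over one variable. [folklore] -/
theorem bitRaw_valid : RawBP.Valid 1 bitRaw := by decide

/-- `bitRaw` reads the input bit `x₀`. [folklore] -/
theorem bitRaw_fn (z : Fin 1 → Bool) : (RawBP.compile 1 bitRaw).2.fn z = z 0 := by
  rw [RawBP.compile_of_valid bitRaw_valid]
  set P := RawBP.toBDD 1 bitRaw bitRaw_valid with hP
  have e2 : P.node ⟨2, by decide⟩ = .branch 0 ⟨0, by decide⟩ ⟨1, by decide⟩ := by decide
  have e1 : P.node ⟨1, by decide⟩ = .leaf true := by decide
  have e0 : P.node ⟨0, by decide⟩ = .leaf false := by decide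
  have h2 := BDD.eval_of_branch (z := z) e2
  have h1 := BDD.eval_of_leaf (z := z) e1
  have h0 := BDD.eval_of_leaf (z := z) e0
  change P.eval z P.root = _
  rw [show P.root = ⟨2, by decide⟩ from rfl, h2, h1, h0]
  cases z 0 <;> rfl

/-- The one-bit sampler `x₀ ↦ x₀` has entropy `1`. [folklore] -/
theorem bpEntropy_bitRaw : bpEntropy 1 [bitRaw] = 1 := by
  unfold bpEntropy
  have h : bpMap 1 [bitRaw] = fun x => [toInput x 0] := by
    funext x
    simp [bpMap, fnList, compileAll, bitRaw_fn]
  rw [h, Literature.InformationTheory.Entropy.mapEntropy_of_injective]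
  · rw [Finset.card_univ, Fintype.card_pi, Finset.prod_const, ZMod.card, Finset.card_univ,
      Fintype.card_fin]
    norm_num
  · intro x y hxy
    have h0 : toInput x 0 = toInput y 0 := by
      have := congrArg List.head? hxy
      simpa using this
    have key : ∀ a b : ZMod 2, decide (a = 1) = decide (b = 1) → a = b := by decide
    funext i
    have hi : i = 0 := Subsingleton.elim _ _
    subst hi
    exact key _ _ h0

/-- `noI` is a NO-instance of `PEDBPGap 1 10` (`0 + 1/10 ≤ 1`). [folklore] -/
theorem encode_noI_mem_no : PEDBPInst.encoding.encode noI ∈ (PEDBPGap 1 10).no := by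
  rw [encode_mem_PEDBPGap_no_iff]
  show bpEntropy 0 [] + ((1 : ℕ) : ℝ) / ((10 : ℕ) : ℝ) ≤ bpEntropy 1 [bitRaw]
  rw [bpEntropy_nil, bpEntropy_bitRaw]
  norm_num

/-- `yesI` is a YES-instance of `PEDBPGap 1 10` (`0 ≤ 0`). [folklore] -/
theorem encode_yesI_mem_yes : PEDBPInst.encoding.encode yesI ∈ (PEDBPGap 1 10).yes := by
  rw [encode_mem_PEDBPGap_yes_iff]
  exact le_refl _


/-! ### The raw tuple of a typed instance -/

/-- The basis entries read off the tuple of a typed instance. [folklore] -/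
theorem tup_entry {n : ℕ} (B : Matrix (Fin n) (Fin n) ℤ) (t : Fin n → ℤ) (d : ℚ) (i' i : Fin n) :
    CVPTup.entry (GapCodes.cvpTup ((⟨⟨n, B⟩, t⟩ : CVPInstance), d)) i' i = B i' i := by
  show (rowMajor n (GapCodes.matRows B)).getD ((i' : ℕ) * n + i) 0 = B i' i
  have hi' := i'.isLt
  have hi := i.isLt
  have hm : (i' : ℕ) * n + i < n * n := by nlinarith
  rw [rowMajor, LMat.getD_map_range _ hm]
  have hdiv : ((i' : ℕ) * n + i) / n = i' := by
    rw [Nat.add_comm, Nat.add_mul_div_right _ _ (by omega), Nat.div_eq_of_lt hi, Nat.zero_add]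
  have hmod : ((i' : ℕ) * n + i) % n = i := by
    rw [Nat.add_comm, Nat.add_mul_mod_self_right, Nat.mod_eq_of_lt hi]
  rw [hdiv, hmod]
  exact GapCodes.ent_matRows B i' i

/-- The target entries read off the tuple of a typed instance. [folklore] -/
theorem tup_tgt {n : ℕ} (B : Matrix (Fin n) (Fin n) ℤ) (t : Fin n → ℤ) (d : ℚ) (i : Fin n) :
    CVPTup.tgt (GapCodes.cvpTup ((⟨⟨n, B⟩, t⟩ : CVPInstance), d)) i = t i := by
  show (List.ofFn t).getD (i : ℕ) 0 = t i
  rw [List.getD_eq_getElem _ _ (by simp), List.getElem_ofFn]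

/-! ### Dimension `≥ 2`: real arithmetic of the parameters -/

/-- `(∑ᵢ |wᵢ|)² ≤ n ∑ᵢ wᵢ²` (Cauchy–Schwarz against the all-ones vector). [folklore] -/
theorem gap_sum_abs_sq_le {n : ℕ} (w : Fin n → ℝ) : (∑ i, |w i|) ^ 2 ≤ n * ∑ i, (w i) ^ 2 := by
  have h := Finset.sum_mul_sq_le_sq_mul_sq (Finset.univ : Finset (Fin n)) (fun i => |w i|) (fun _ => (1 : ℝ))
  simp only [mul_one, one_pow, Finset.sum_const, Finset.card_univ, Fintype.card_fin, nsmul_eq_mul,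
    sq_abs] at h
  linarith [h]

/-- The real inequalities behind the two chains: with `s = √n ∈ [7/5, n]`, `64 n a < M`,
`(M − 1) den ≤ s K a ≤ (M − 1) den + s a` one has `M − 1 ≤ s K d`, `K d ≤ (3/4) M` and
`s K d ≤ M − 1 + M / 64` (`d = a / den`). [folklore] -/
theorem gap_arith (M a dn K s n : ℝ) (hs : 7 / 5 ≤ s) (hsn : s ≤ n) (hn : 2 ≤ n) (ha : 0 ≤ a)
    (hdn : 1 ≤ dn) (hM1 : 1 ≤ M) (hM : 64 * n * a < M) (hlo : (M - 1) * dn ≤ s * K * a)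
    (hhi : s * K * a ≤ (M - 1) * dn + s * a) :
    M - 1 ≤ s * K * (a / dn) ∧ K * (a / dn) ≤ 3 / 4 * M ∧ s * (K * (a / dn)) ≤ (M - 1) + M / 64 := by
  have hdn0 : 0 < dn := by linarith
  have hs0 : 0 < s := by linarith
  have hadn : a / dn ≤ a := div_le_self ha hdn
  have hadn0 : 0 ≤ a / dn := div_nonneg ha hdn0.le
  have h1 : M - 1 ≤ s * K * (a / dn) := by
    rw [show s * K * (a / dn) = (s * K * a) / dn by ring, le_div_iff₀ hdn0]
    exact hlo
  have h2 : s * (K * (a / dn)) ≤ (M - 1) + s * (a / dn) := by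
    rw [show s * (K * (a / dn)) = (s * K * a) / dn by ring, div_le_iff₀ hdn0]
    have : ((M - 1) + s * (a / dn)) * dn = (M - 1) * dn + s * a := by field_simp
    rw [this]
    exact hhi
  have hsa : s * (a / dn) ≤ n * a := by
    calc s * (a / dn) ≤ s * a := mul_le_mul_of_nonneg_left hadn hs0.le
      _ ≤ n * a := mul_le_mul_of_nonneg_right hsn ha
  have hna : n * a ≤ M / 64 := by
    rw [le_div_iff₀ (by norm_num : (0:ℝ) < 64)]
    linarith
  have h3 : s * (K * (a / dn)) ≤ (M - 1) + M / 64 := by linarith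
  -- `K d ≤ (M − 1)/s + a/dn ≤ (5/7)(M − 1) + M/128`
  have h4 : K * (a / dn) ≤ (M - 1) / s + a / dn := by
    rw [show (M - 1) / s + a / dn = ((M - 1) + s * (a / dn)) / s by field_simp, le_div_iff₀ hs0]
    linarith
  have h5 : (M - 1) / s ≤ (M - 1) / (7 / 5) :=
    div_le_div_of_nonneg_left (by linarith) (by norm_num) hs
  have h6 : a ≤ M / 128 := by
    rw [le_div_iff₀ (by norm_num : (0:ℝ) < 128)]
    nlinarith
  have h7 : K * (a / dn) ≤ 3 / 4 * M := by
    have : (M - 1) / (7 / 5) = 5 / 7 * (M - 1) := by ring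
    rw [this] at h5
    linarith
  exact ⟨h1, h7, h3⟩

/-! ### Dimension `≥ 2`: the entropies of the two samplers -/

section Generic

variable (n : ℕ) (B : Matrix (Fin n) (Fin n) ℤ) (t : Fin n → ℤ) (d : ℚ)

/-- **The entropies of the two samplers of a typed instance** (`n ≥ 2`, `d > 0`): `H(p)` is the
entropy of the mixture `b ? f : g`, `H(q) = H(g) + 1`, and `H(f) = H(g)` (translate); together with
the parameter facts of `stub_params`. [cite: DvirGutfreundRothblumVadhan2010, §4.4] -/
theorem gap_entropies (c : CVPTup) (hc : c = GapCodes.cvpTup ((⟨⟨n, B⟩, t⟩ : CVPInstance), d))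
    (hn : 2 ≤ n) (hd : 0 < d) :
    bpEntropy c.N c.progsP = mapEntropy (Finset.univ : Finset (Bool × Box n c.ℓ c.m))
        (fun p => if p.1 then sampF n (c.K : ℤ) B t p.2 else sampG n (c.K : ℤ) B p.2) ∧
      bpEntropy c.N c.progsQ = mapEntropy (Finset.univ : Finset (Box n c.ℓ c.m)) (sampG n (c.K : ℤ) B) + 1 ∧
      mapEntropy (Finset.univ : Finset (Box n c.ℓ c.m)) (sampF n (c.K : ℤ) B t) =
        mapEntropy (Finset.univ : Finset (Box n c.ℓ c.m)) (sampG n (c.K : ℤ) B) ∧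
      (1 ≤ c.K ∧ 64 * c.n * c.a < c.M ∧ ((c.M : ℝ) - 1) * c.den ≤ Real.sqrt c.n * c.K * c.a ∧
        Real.sqrt c.n * c.K * c.a ≤ ((c.M : ℝ) - 1) * c.den + Real.sqrt c.n * c.a ∧
        32 * c.n * (c.n.factorial * c.S₀ ^ c.n) ≤ 2 ^ c.ℓ ∧ (∀ i' i : ℕ, (c.entry i' i).natAbs ≤ c.S₀) ∧
        (∀ i : ℕ, (c.tgt i).natAbs + c.a ≤ c.S₀)) ∧
      c.n = n ∧ 0 < c.num ∧ 0 < c.den ∧ (∀ i' i : Fin n, c.entry i' i = B i' i) ∧ (∀ i : Fin n, c.tgt i = t i) := by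
  have hcn : c.n = n := by rw [hc]; rfl
  have hnum : 0 < c.num := by rw [hc]; exact Rat.num_pos.2 hd
  have hden : 0 < c.den := by rw [hc]; exact d.den_pos
  obtain ⟨hK1, hM, hKlo, hKhi, hℓ, hentry, htgt, hWP, hWQ⟩ := stub_params c (hcn ▸ hn) hnum hden
  have hBc : ∀ i' i : Fin n, c.entry i' i = B i' i := fun i' i => by rw [hc]; exact tup_entry B t d i' i
  have htc : ∀ i : Fin n, c.tgt i = t i := fun i => by rw [hc]; exact tup_tgt B t d i
  obtain ⟨hsemP, hsemQ⟩ := stub_bpSemantics c hWP hWQ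
  subst hcn
  obtain ⟨hreP, hreQ⟩ := stub_reindex c c.n B t rfl hBc htc
  refine ⟨?_, ?_, ?_, ⟨hK1, hM, hKlo, hKhi, hℓ, hentry, htgt⟩, rfl, hnum, hden, hBc, htc⟩
  · unfold bpEntropy
    rw [mapEntropy_univ_eq_of_ker_eq hsemP]
    exact hreP
  · unfold bpEntropy
    rw [mapEntropy_univ_eq_of_ker_eq hsemQ]
    exact hreQ
  · have e : (sampF c.n (c.K : ℤ) B t : Box c.n c.ℓ c.m → Fin c.n → ℤ) =
        (fun v => v + fun i => (c.K : ℤ) * t i) ∘ sampG c.n (c.K : ℤ) B := by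
      funext ze
      funext i
      simp [sampF]
    rw [e]
    exact Literature.InformationTheory.Entropy.mapEntropy_comp_of_injOn _ _
      fun a _ b _ h => add_right_cancel h

end Generic

/-- `(d : ℝ) < z ↔ num d < den d · z` for an integer `z`. [folklore] -/
theorem gap_rat_lt_int_iff (d : ℚ) (z : ℤ) : (d : ℝ) < (z : ℝ) ↔ d.num < (d.den : ℤ) * z := by
  have hden : (0 : ℝ) < d.den := by exact_mod_cast d.den_pos
  have h1 : (d : ℝ) = (d.num : ℝ) / (d.den : ℝ) := by exact_mod_cast (Rat.num_div_den d).symm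
  rw [h1, div_lt_iff₀ hden]
  constructor
  · intro h
    have : ((d.num : ℤ) : ℝ) < (((d.den : ℤ) * z : ℤ) : ℝ) := by push_cast; linarith
    exact_mod_cast this
  · intro h
    have : ((d.num : ℤ) : ℝ) < (((d.den : ℤ) * z : ℤ) : ℝ) := by exact_mod_cast h
    push_cast at this
    linarith

end Summit.PneNP.PneNP.Cruxes.PeaThreeNotInP.LatticeLine
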